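import Summits.QuantumFields.YangMills.Theorems.ParabolicTrajectoryParabolicCentreCurveEstimates

/-!
# Route `ParabolicTrajectory` — item `ParabolicCentreCurve` (stmt-QuantumFields-9175): the invariant graph

Support file: construction of the centre-unstable curve of the abstract parabolic step
`F(g, y) = (φ g y, Ψ g y)` by a **coupled graph transform**, avoiding any inverse-function
bookkeeping. The unknown is a pair `(σ, h)` of functions on `[0, δ₁]` (extended to `ℝ` by clamping
the argument): `h` is the graph and `σ` the inverse of the base map along the graph. The operator

  `T(σ, h)(s) = ( s − (φ(x, h x) − x),  Ψ(x, h x) )`, `x := σ s`,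

acts on the closed subset `X` of the Banach space `ℝ →ᵇ ℝ × E` cut out by
`0 ≤ σ s ≤ s`, `‖h s‖ ≤ C' s²`, `Lip σ ≤ S`, `Lip h ≤ L`, and is a `κ`-contraction there
(`exists_backward_graph`, via `ContractingWith.fixedPoint`). Its fixed point is *backward* invariant:
`F(σ s, h (σ s)) = (s, h s)`; strict monotonicity of the base map along a Lipschitz graph
(`strictMonoOn_base`) upgrades this to forward invariance `Ψ g (h g) = h (φ g (h g))`
(`forward_invariance`). Constants: `(1 − θ) C' = 2C`, `L ≤ 1 ≤ S`, `κ < 1` subject to the four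
inequalities `hR2 … hR5`, all met for small `δ₁` (see `consts_ineq` in the estimates file).

Scheme: Lipschitz graph transform for a dominated splitting (Hirsch–Pugh–Shub 1977 §5), parabolic
case as in Baldomá–Fontich–de la Llave–Martín 2007; the coupled `(σ, h)` formulation is ours.
-/

open Set Filter Topology BoundedContinuousFunction

namespace Summit.QuantumFields.YangMills.Theorems.ParabolicCentreCurve

variable {E : Type} [NormedAddCommGroup E] [NormedSpace ℝ E] [CompleteSpace E]
  {φ : ℝ → E → ℝ} {Ψ : ℝ → E → E} {A : E →L[ℝ] E} {b θ C δ : ℝ}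

variable
  (H1 : ∀ g : ℝ, ∀ y : E, |g| ≤ δ → ‖y‖ ≤ δ →
    |φ g y - (g + b * g ^ 3)| ≤ C * (g ^ 4 + |g| ^ 3 * ‖y‖) ∧ ‖Ψ g y - A y‖ ≤ C * (g ^ 2 + ‖y‖ ^ 2))
  (H2 : ∀ g : ℝ, ∀ y y' : E, |g| ≤ δ → ‖y‖ ≤ δ → ‖y'‖ ≤ δ →
    |φ g y - φ g y'| ≤ C * |g| ^ 3 * ‖y - y'‖ ∧
      ‖Ψ g y - Ψ g y' - A (y - y')‖ ≤ C * (|g| + ‖y‖ + ‖y'‖) * ‖y - y'‖)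
  (H3 : ∀ g g' : ℝ, ∀ y : E, |g| ≤ δ → |g'| ≤ δ → ‖y‖ ≤ δ →
    |φ g y - φ g' y - (g - g') - b * (g ^ 3 - g' ^ 3)| ≤
        C * (max |g| |g'|) ^ 2 * (max |g| |g'| + ‖y‖) * |g - g'| ∧
      ‖Ψ g y - Ψ g' y‖ ≤ C * (|g| + |g'| + ‖y‖) * |g - g'|)

include H1 H2 H3 in
/-- **Backward-invariant Lipschitz graph by the coupled graph transform.** Under the hypothesis
block and the smallness/constant conditions, there are `σ` and `h` with `0 ≤ σ s ≤ s`,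
`‖h s‖ ≤ C' s²` on `[0, δ₁]`, `h` globally `L`-Lipschitz, and `F(σ s, h (σ s)) = (s, h s)` for
`s ∈ [0, δ₁]`. [folklore] -/
theorem exists_backward_graph (hθ : 0 ≤ θ) (hb : 0 < b) (hC : 0 < C) (hA : ‖A‖ ≤ θ)
    {δ₁ C' L S κ : ℝ} (hδ₁ : 0 < δ₁) (hδ₁δ : δ₁ ≤ δ) (hK2 : 2 * C * δ₁ ≤ b)
    (hK3 : 2 * b * δ₁ ^ 2 ≤ 1) (hC' : (1 - θ) * C' = 2 * C) (hC'0 : 0 ≤ C') (hC'δ₁ : C' * δ₁ ≤ 1)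
    (hL0 : 0 < L) (hL1 : L ≤ 1) (hS1 : 1 ≤ S) (hκ0 : 0 ≤ κ) (hκ1 : κ < 1)
    (hR2 : 1 + (3 * b * δ₁ ^ 2 + 3 * C * δ₁ ^ 3) * S ≤ S)
    (hR3 : (3 * C * δ₁ + (θ + 3 * C * δ₁) * L) * S ≤ L)
    (hR4 : 3 * b * δ₁ ^ 2 + 4 * C * δ₁ ^ 3 ≤ κ)
    (hR5 : 3 * C * δ₁ + (θ + 3 * C * δ₁) * (L + 1) ≤ κ) :
    ∃ σ : ℝ → ℝ, ∃ h : ℝ → E,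
      (∀ s ∈ Icc (0 : ℝ) δ₁, 0 ≤ σ s ∧ σ s ≤ s) ∧
      (∀ s ∈ Icc (0 : ℝ) δ₁, ‖h s‖ ≤ C' * s ^ 2) ∧
      (∀ t t', ‖h t - h t'‖ ≤ L * |t - t'|) ∧
      (∀ s ∈ Icc (0 : ℝ) δ₁, φ (σ s) (h (σ s)) = s) ∧
      (∀ s ∈ Icc (0 : ℝ) δ₁, h s = Ψ (σ s) (h (σ s))) := by
  have hS0 : (0 : ℝ) ≤ S := zero_le_one.trans hS1
  /- the clamp `cl t = max 0 (min δ₁ t)` -/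
  obtain ⟨cl, hcl⟩ : ∃ cl : ℝ → ℝ, ∀ t, cl t = max 0 (min δ₁ t) := ⟨_, fun t => rfl⟩
  have cl0 : ∀ t, 0 ≤ cl t := fun t => by rw [hcl]; exact le_max_left _ _
  have cl1 : ∀ t, cl t ≤ δ₁ := fun t => by rw [hcl]; exact max_le hδ₁.le (min_le_left _ _)
  have cl_id : ∀ s, 0 ≤ s → s ≤ δ₁ → cl s = s := fun s h0 h1 => by
    rw [hcl, min_eq_right h1, max_eq_right h0]
  have clcl : ∀ t, cl (cl t) = cl t := fun t => cl_id _ (cl0 t) (cl1 t)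
  have cl_lip : ∀ t t', |cl t - cl t'| ≤ |t - t'| := fun t t' => by
    have h1 := abs_max_sub_max_le_max 0 (min δ₁ t) 0 (min δ₁ t')
    have h2 := abs_min_sub_min_le_max δ₁ t δ₁ t'
    simp only [sub_self, abs_zero] at h1 h2
    rw [max_eq_right (abs_nonneg (min δ₁ t - min δ₁ t'))] at h1
    rw [max_eq_right (abs_nonneg (t - t'))] at h2
    rw [hcl, hcl]
    exact h1.trans h2
  /- the closed set `X` -/
  have hev : ∀ t : ℝ, Continuous fun f : ℝ →ᵇ ℝ × E => f t := fun t => continuous_eval_const t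
  obtain ⟨X, hXdef⟩ : ∃ X : Set (ℝ →ᵇ ℝ × E),
      ∀ f, f ∈ X ↔ ((∀ t, 0 ≤ (f t).1 ∧ (f t).1 ≤ cl t) ∧ (∀ t, ‖(f t).2‖ ≤ C' * cl t ^ 2) ∧
        (∀ t t', |(f t).1 - (f t').1| ≤ S * |t - t'|) ∧
        (∀ t t', ‖(f t).2 - (f t').2‖ ≤ L * |t - t'|)) := ⟨_, fun f => Iff.rfl⟩
  have hXc : IsClosed X := by
    have e : X = (⋂ t, {f : ℝ →ᵇ ℝ × E | 0 ≤ (f t).1} ∩ {f | (f t).1 ≤ cl t}) ∩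
        ((⋂ t, {f : ℝ →ᵇ ℝ × E | ‖(f t).2‖ ≤ C' * cl t ^ 2}) ∩
        ((⋂ t, ⋂ t', {f : ℝ →ᵇ ℝ × E | |(f t).1 - (f t').1| ≤ S * |t - t'|}) ∩
        (⋂ t, ⋂ t', {f : ℝ →ᵇ ℝ × E | ‖(f t).2 - (f t').2‖ ≤ L * |t - t'|}))) := by
      ext f
      simp only [hXdef, Set.mem_inter_iff, Set.mem_iInter, Set.mem_setOf_eq]
    rw [e]
    exact (isClosed_iInter fun t => (isClosed_le continuous_const (hev t).fst).inter
      (isClosed_le (hev t).fst continuous_const)).inter ((isClosed_iInter fun t =>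
      isClosed_le (hev t).snd.norm continuous_const).inter ((isClosed_iInter fun t =>
      isClosed_iInter fun t' => isClosed_le ((hev t).fst.sub (hev t').fst).abs
      continuous_const).inter (isClosed_iInter fun t => isClosed_iInter fun t' =>
      isClosed_le ((hev t).snd.sub (hev t').snd).norm continuous_const)))
  have h0X : (0 : ℝ →ᵇ ℝ × E) ∈ X := by
    refine (hXdef 0).2 ⟨fun t => ?_, fun t => ?_, fun t t' => ?_, fun t t' => ?_⟩
    · simp only [BoundedContinuousFunction.coe_zero, Pi.zero_apply, Prod.fst_zero]
      exact ⟨le_rfl, cl0 t⟩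
    · simp only [BoundedContinuousFunction.coe_zero, Pi.zero_apply, Prod.snd_zero, norm_zero]
      positivity
    · simp only [BoundedContinuousFunction.coe_zero, Pi.zero_apply, Prod.fst_zero, sub_zero,
        abs_zero]
      positivity
    · simp only [BoundedContinuousFunction.coe_zero, Pi.zero_apply, Prod.snd_zero, sub_zero,
        norm_zero]
      positivity
  /- point facts for members of `X` -/
  have hpt : ∀ f ∈ X, ∀ t, 0 ≤ (f (cl t)).1 ∧ (f (cl t)).1 ≤ cl t ∧
      ‖(f (f (cl t)).1).2‖ ≤ C' * (f (cl t)).1 ^ 2 ∧ ‖(f (f (cl t)).1).2‖ ≤ δ₁ := by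
    intro f hf t
    obtain ⟨m1, m2, -, -⟩ := (hXdef f).1 hf
    have hx := m1 (cl t)
    rw [clcl] at hx
    have hxδ₁ : (f (cl t)).1 ≤ δ₁ := hx.2.trans (cl1 t)
    have hy := m2 (f (cl t)).1
    rw [cl_id _ hx.1 hxδ₁] at hy
    refine ⟨hx.1, hx.2, hy, ?_⟩
    calc ‖(f (f (cl t)).1).2‖ ≤ C' * (f (cl t)).1 ^ 2 := hy
      _ = C' * (f (cl t)).1 * (f (cl t)).1 := by ring
      _ ≤ 1 * (f (cl t)).1 :=
          mul_le_mul_of_nonneg_right ((mul_le_mul_of_nonneg_left hxδ₁ hC'0).trans hC'δ₁) hx.1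
      _ ≤ δ₁ := by rw [one_mul]; exact hxδ₁
  /- the raw operator -/
  obtain ⟨Tf, hTf⟩ : ∃ Tf : (ℝ →ᵇ ℝ × E) → ℝ → ℝ × E, ∀ f t, Tf f t =
      (cl t - (φ (f (cl t)).1 (f (f (cl t)).1).2 - (f (cl t)).1),
        Ψ (f (cl t)).1 (f (f (cl t)).1).2) := ⟨_, fun f t => rfl⟩
  have T2 : ∀ f ∈ X, ∀ t, 0 ≤ (Tf f t).1 ∧ (Tf f t).1 ≤ cl t := by
    intro f hf t
    obtain ⟨hx0, hxs, -, hyδ₁⟩ := hpt f hf t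
    rw [hTf]
    dsimp only
    set s := cl t
    set x := (f s).1
    set y := (f x).2
    have hbs := base_step_bounds (H1 := H1) hC hδ₁δ hK2 hx0 (hxs.trans (cl1 t)) hyδ₁
    constructor
    · have hx3 : x ^ 3 ≤ s ^ 2 * s := by
        calc x ^ 3 ≤ s ^ 3 := pow_le_pow_left₀ hx0 hxs 3
          _ = s ^ 2 * s := by ring
      have hs2 : s ^ 2 ≤ δ₁ ^ 2 := pow_le_pow_left₀ (cl0 t) (cl1 t) 2
      have h1 : 2 * b * x ^ 3 ≤ 2 * b * (s ^ 2 * s) :=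
        mul_le_mul_of_nonneg_left hx3 (by positivity)
      have h2 : 2 * b * (s ^ 2 * s) ≤ 2 * b * (δ₁ ^ 2 * s) :=
        mul_le_mul_of_nonneg_left (mul_le_mul_of_nonneg_right hs2 (cl0 t)) (by positivity)
      have h3 : 2 * b * (δ₁ ^ 2 * s) = (2 * b * δ₁ ^ 2) * s := by ring
      have h4 : (2 * b * δ₁ ^ 2) * s ≤ 1 * s := mul_le_mul_of_nonneg_right hK3 (cl0 t)
      linarith [hbs.2]
    · linarith [hbs.1]
  have T3 : ∀ f ∈ X, ∀ t, ‖(Tf f t).2‖ ≤ C' * cl t ^ 2 := by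
    intro f hf t
    obtain ⟨hx0, hxs, hyx, -⟩ := hpt f hf t
    rw [hTf]
    dsimp only
    calc ‖Ψ (f (cl t)).1 (f (f (cl t)).1).2‖ ≤ C' * (f (cl t)).1 ^ 2 :=
          fibre_bound (H1 := H1) hθ hC hA hδ₁δ hC' hC'0 hC'δ₁ hx0 (hxs.trans (cl1 t)) hyx
      _ ≤ C' * cl t ^ 2 := mul_le_mul_of_nonneg_left (pow_le_pow_left₀ hx0 hxs 2) hC'0
  have T4 : ∀ f ∈ X, ∀ t t', |(Tf f t).1 - (Tf f t').1| ≤ S * |t - t'| := by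
    intro f hf t t'
    obtain ⟨hx0, hxs, -, hyδ₁⟩ := hpt f hf t
    obtain ⟨hx0', hxs', -, hyδ₁'⟩ := hpt f hf t'
    obtain ⟨-, -, m3, m4⟩ := (hXdef f).1 hf
    rw [hTf, hTf]
    dsimp only
    set s := cl t
    set s' := cl t'
    set x := (f s).1
    set x' := (f s').1
    set y := (f x).2
    set y' := (f x').2
    have hN := base_lipschitz (H2 := H2) (H3 := H3) hb hC hδ₁δ hx0 (hxs.trans (cl1 t)) hx0'
      (hxs'.trans (cl1 t')) hyδ₁ hyδ₁'
    have hxx : |x - x'| ≤ S * |s - s'| := m3 s s'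
    have hyy : ‖y - y'‖ ≤ 1 * |x - x'| := (m4 x x').trans (by gcongr)
    have hss : |s - s'| ≤ |t - t'| := cl_lip t t'
    have e : s - (φ x y - x) - (s' - (φ x' y' - x')) =
        (s - s') - ((φ x y - x) - (φ x' y' - x')) := by ring
    rw [e]
    calc |(s - s') - ((φ x y - x) - (φ x' y' - x'))|
          ≤ |s - s'| + |(φ x y - x) - (φ x' y' - x')| := abs_sub _ _
      _ ≤ |s - s'| + ((3 * b * δ₁ ^ 2 + 2 * C * δ₁ ^ 3) * |x - x'| +
            C * δ₁ ^ 3 * (1 * |x - x'|)) := by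
          have := mul_le_mul_of_nonneg_left hyy (by positivity : (0 : ℝ) ≤ C * δ₁ ^ 3)
          linarith
      _ = |s - s'| + (3 * b * δ₁ ^ 2 + 3 * C * δ₁ ^ 3) * |x - x'| := by ring
      _ ≤ |s - s'| + (3 * b * δ₁ ^ 2 + 3 * C * δ₁ ^ 3) * (S * |s - s'|) := by gcongr
      _ = (1 + (3 * b * δ₁ ^ 2 + 3 * C * δ₁ ^ 3) * S) * |s - s'| := by ring
      _ ≤ S * |s - s'| := mul_le_mul_of_nonneg_right hR2 (abs_nonneg _)
      _ ≤ S * |t - t'| := mul_le_mul_of_nonneg_left hss hS0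
  have T5 : ∀ f ∈ X, ∀ t t', ‖(Tf f t).2 - (Tf f t').2‖ ≤ L * |t - t'| := by
    intro f hf t t'
    obtain ⟨hx0, hxs, -, hyδ₁⟩ := hpt f hf t
    obtain ⟨hx0', hxs', -, hyδ₁'⟩ := hpt f hf t'
    obtain ⟨-, -, m3, m4⟩ := (hXdef f).1 hf
    rw [hTf, hTf]
    dsimp only
    set s := cl t
    set s' := cl t'
    set x := (f s).1
    set x' := (f s').1
    set y := (f x).2
    set y' := (f x').2
    have hΨ := fibre_lipschitz (H2 := H2) (H3 := H3) hC hA hδ₁δ hx0 (hxs.trans (cl1 t)) hx0'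
      (hxs'.trans (cl1 t')) hyδ₁ hyδ₁'
    have hxx : |x - x'| ≤ S * |s - s'| := m3 s s'
    have hyy : ‖y - y'‖ ≤ L * |x - x'| := m4 x x'
    have hss : |s - s'| ≤ |t - t'| := cl_lip t t'
    calc ‖Ψ x y - Ψ x' y'‖ ≤ 3 * C * δ₁ * |x - x'| + (θ + 3 * C * δ₁) * ‖y - y'‖ := hΨ
      _ ≤ 3 * C * δ₁ * |x - x'| + (θ + 3 * C * δ₁) * (L * |x - x'|) := by gcongr
      _ = (3 * C * δ₁ + (θ + 3 * C * δ₁) * L) * |x - x'| := by ring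
      _ ≤ (3 * C * δ₁ + (θ + 3 * C * δ₁) * L) * (S * |s - s'|) := by gcongr
      _ = ((3 * C * δ₁ + (θ + 3 * C * δ₁) * L) * S) * |s - s'| := by ring
      _ ≤ L * |s - s'| := mul_le_mul_of_nonneg_right hR3 (abs_nonneg _)
      _ ≤ L * |t - t'| := mul_le_mul_of_nonneg_left hss hL0.le
  have T6 : ∀ f ∈ X, ∀ f' ∈ X, ∀ t, ‖Tf f t - Tf f' t‖ ≤ κ * dist f f' := by
    intro f hf f' hf' t
    obtain ⟨hx0, hxs, -, hyδ₁⟩ := hpt f hf t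
    obtain ⟨hx0', hxs', -, hyδ₁'⟩ := hpt f' hf' t
    obtain ⟨-, -, -, m4⟩ := (hXdef f).1 hf
    rw [hTf, hTf]
    set s := cl t
    set x := (f s).1
    set x' := (f' s).1
    set y := (f x).2
    set y' := (f' x').2
    set d := dist f f'
    have hd0 : 0 ≤ d := dist_nonneg
    have hxx : |x - x'| ≤ d := by
      calc |x - x'| = ‖(f s - f' s).1‖ := by rw [Prod.fst_sub, Real.norm_eq_abs]
        _ ≤ ‖f s - f' s‖ := norm_fst_le _
        _ = dist (f s) (f' s) := (dist_eq_norm _ _).symm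
        _ ≤ d := dist_coe_le_dist s
    have hyy : ‖y - y'‖ ≤ (L + 1) * d := by
      have h1 : ‖(f x).2 - (f x').2‖ ≤ L * |x - x'| := m4 x x'
      have h2 : ‖(f x').2 - (f' x').2‖ ≤ d := by
        calc ‖(f x').2 - (f' x').2‖ = ‖(f x' - f' x').2‖ := by rw [Prod.snd_sub]
          _ ≤ ‖f x' - f' x'‖ := norm_snd_le _
          _ = dist (f x') (f' x') := (dist_eq_norm _ _).symm
          _ ≤ d := dist_coe_le_dist x'
      calc ‖y - y'‖ = ‖((f x).2 - (f x').2) + ((f x').2 - (f' x').2)‖ := by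
            rw [sub_add_sub_cancel]
        _ ≤ ‖(f x).2 - (f x').2‖ + ‖(f x').2 - (f' x').2‖ := norm_add_le _ _
        _ ≤ L * |x - x'| + d := add_le_add h1 h2
        _ ≤ L * d + d := by gcongr
        _ = (L + 1) * d := by ring
    have hN := base_lipschitz (H2 := H2) (H3 := H3) hb hC hδ₁δ hx0 (hxs.trans (cl1 t)) hx0'
      (hxs'.trans (cl1 t)) hyδ₁ hyδ₁'
    have hΨ := fibre_lipschitz (H2 := H2) (H3 := H3) hC hA hδ₁δ hx0 (hxs.trans (cl1 t)) hx0'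
      (hxs'.trans (cl1 t)) hyδ₁ hyδ₁'
    have c1 : |(s - (φ x y - x)) - (s - (φ x' y' - x'))| ≤ κ * d := by
      have e : (s - (φ x y - x)) - (s - (φ x' y' - x')) = -((φ x y - x) - (φ x' y' - x')) := by
        ring
      rw [e, abs_neg]
      calc |(φ x y - x) - (φ x' y' - x')|
            ≤ (3 * b * δ₁ ^ 2 + 2 * C * δ₁ ^ 3) * |x - x'| + C * δ₁ ^ 3 * ‖y - y'‖ := hN
        _ ≤ (3 * b * δ₁ ^ 2 + 2 * C * δ₁ ^ 3) * d + C * δ₁ ^ 3 * ((L + 1) * d) := by gcongr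
        _ ≤ (3 * b * δ₁ ^ 2 + 2 * C * δ₁ ^ 3) * d + C * δ₁ ^ 3 * (2 * d) := by
            gcongr; linarith
        _ = (3 * b * δ₁ ^ 2 + 4 * C * δ₁ ^ 3) * d := by ring
        _ ≤ κ * d := mul_le_mul_of_nonneg_right hR4 hd0
    have c2 : ‖Ψ x y - Ψ x' y'‖ ≤ κ * d := by
      calc ‖Ψ x y - Ψ x' y'‖ ≤ 3 * C * δ₁ * |x - x'| + (θ + 3 * C * δ₁) * ‖y - y'‖ := hΨ
        _ ≤ 3 * C * δ₁ * d + (θ + 3 * C * δ₁) * ((L + 1) * d) := by gcongr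
        _ = (3 * C * δ₁ + (θ + 3 * C * δ₁) * (L + 1)) * d := by ring
        _ ≤ κ * d := mul_le_mul_of_nonneg_right hR5 hd0
    rw [Prod.mk_sub_mk, Prod.norm_def]
    exact max_le (by rw [Real.norm_eq_abs]; exact c1) c2
  /- `Tf f` is a bounded continuous function for `f ∈ X` -/
  have Tcont : ∀ f ∈ X, Continuous (Tf f) := by
    intro f hf
    have h1 : Continuous fun t => (Tf f t).1 :=
      (LipschitzWith.of_dist_le_mul (K := S.toNNReal) fun t t' => by
        rw [Real.dist_eq, Real.dist_eq, Real.coe_toNNReal _ hS0]; exact T4 f hf t t').continuous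
    have h2 : Continuous fun t => (Tf f t).2 :=
      (LipschitzWith.of_dist_le_mul (K := L.toNNReal) fun t t' => by
        rw [dist_eq_norm, Real.dist_eq, Real.coe_toNNReal _ hL0.le]
        exact T5 f hf t t').continuous
    exact h1.prodMk h2
  have Tbdd : ∀ f ∈ X, ∀ t, ‖Tf f t‖ ≤ max δ₁ (C' * δ₁ ^ 2) := by
    intro f hf t
    have h1 := T2 f hf t
    have h2 := T3 f hf t
    rw [Prod.norm_def]
    refine max_le_max ?_ ?_
    · rw [Real.norm_eq_abs, abs_of_nonneg h1.1]; exact h1.2.trans (cl1 t)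
    · exact h2.trans (mul_le_mul_of_nonneg_left (pow_le_pow_left₀ (cl0 t) (cl1 t) 2) hC'0)
  /- the operator on `X` and its contraction property -/
  obtain ⟨T, hT⟩ : ∃ T : X → X, ∀ f : X, ∀ t, ((T f : X) : ℝ →ᵇ ℝ × E) t = Tf f t :=
    ⟨fun f => ⟨BoundedContinuousFunction.ofNormedAddCommGroup (Tf f) (Tcont f f.2) _ (Tbdd f f.2),
      (hXdef _).2 ⟨fun t => T2 f f.2 t, fun t => T3 f f.2 t, fun t t' => T4 f f.2 t t',
        fun t t' => T5 f f.2 t t'⟩⟩, fun f t => rfl⟩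
  have hTc : ContractingWith κ.toNNReal T := by
    refine ⟨Real.toNNReal_lt_one.2 hκ1, LipschitzWith.of_dist_le_mul fun f f' => ?_⟩
    · rw [Subtype.dist_eq, Subtype.dist_eq, Real.coe_toNNReal _ hκ0]
      refine (BoundedContinuousFunction.dist_le (mul_nonneg hκ0 dist_nonneg)).2 fun t => ?_
      rw [dist_eq_norm, hT, hT]
      exact T6 f.1 f.2 f'.1 f'.2 t
  /- the fixed point -/
  haveI : CompleteSpace X := hXc.isComplete.completeSpace_coe
  haveI : Nonempty X := ⟨⟨0, h0X⟩⟩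
  have hfix : T (ContractingWith.fixedPoint T hTc) = ContractingWith.fixedPoint T hTc :=
    hTc.fixedPoint_isFixedPt
  set fp := ContractingWith.fixedPoint T hTc with hfp
  have hfpt : ∀ t, Tf fp.1 t = fp.1 t := fun t => by rw [← hT fp t, hfix]
  obtain ⟨m1, m2, -, m4⟩ := (hXdef fp.1).1 fp.2
  refine ⟨fun t => (fp.1 t).1, fun t => (fp.1 t).2, ?_, ?_, m4, ?_, ?_⟩
  · intro s hs
    have := m1 s
    rwa [cl_id s hs.1 hs.2] at this
  · intro s hs
    have := m2 s
    rwa [cl_id s hs.1 hs.2] at this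
  · intro s hs
    have h := congrArg Prod.fst (hfpt s)
    rw [hTf] at h
    dsimp only at h
    rw [cl_id s hs.1 hs.2] at h
    linarith
  · intro s hs
    have h := congrArg Prod.snd (hfpt s)
    rw [hTf] at h
    dsimp only at h
    rw [cl_id s hs.1 hs.2] at h
    exact h.symm

omit [CompleteSpace E] in
include H1 H2 H3 in
/-- **Forward invariance from backward invariance.** If `(σ, h)` is a backward-invariant pair as
produced by `exists_backward_graph`, then the graph of `h` is forward invariant wherever the base
point does not leave `[0, δ₁]`: `Ψ g (h g) = h (φ g (h g))`. Uses strict monotonicity of the base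
map along the Lipschitz graph. [folklore] -/
theorem forward_invariance (hb : 0 < b) (hC : 0 < C) {δ₁ C' L : ℝ} {σ : ℝ → ℝ} {h : ℝ → E}
    (hδ₁δ : δ₁ ≤ δ) (hK2 : 2 * C * δ₁ ≤ b) (hK9 : 3 * C * δ₁ ^ 3 < 1) (hC'0 : 0 ≤ C')
    (hC'δ₁ : C' * δ₁ ≤ 1) (hL1 : L ≤ 1)
    (hσ : ∀ s ∈ Icc (0 : ℝ) δ₁, 0 ≤ σ s ∧ σ s ≤ s)
    (hbd : ∀ s ∈ Icc (0 : ℝ) δ₁, ‖h s‖ ≤ C' * s ^ 2)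
    (hlip : ∀ t t', ‖h t - h t'‖ ≤ L * |t - t'|)
    (hback1 : ∀ s ∈ Icc (0 : ℝ) δ₁, φ (σ s) (h (σ s)) = s)
    (hback2 : ∀ s ∈ Icc (0 : ℝ) δ₁, h s = Ψ (σ s) (h (σ s)))
    {g : ℝ} (hg : g ∈ Icc (0 : ℝ) δ₁) (hug : φ g (h g) ≤ δ₁) :
    Ψ g (h g) = h (φ g (h g)) := by
  have hbd' : ∀ s ∈ Icc (0 : ℝ) δ₁, ‖h s‖ ≤ δ₁ := by
    intro s hs
    calc ‖h s‖ ≤ C' * s ^ 2 := hbd s hs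
      _ = C' * s * s := by ring
      _ ≤ 1 * s :=
          mul_le_mul_of_nonneg_right ((mul_le_mul_of_nonneg_left hs.2 hC'0).trans hC'δ₁) hs.1
      _ ≤ δ₁ := by rw [one_mul]; exact hs.2
  have hmono := strictMonoOn_base (H2 := H2) (H3 := H3) hb hC hδ₁δ hK9 hL1 hlip hbd'
  have hu0 : g ≤ φ g (h g) := by
    have := (base_step_bounds (H1 := H1) hC hδ₁δ hK2 hg.1 hg.2 (hbd' g hg)).1
    linarith
  have hsI : φ g (h g) ∈ Icc (0 : ℝ) δ₁ := ⟨hg.1.trans hu0, hug⟩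
  have hσs : σ (φ g (h g)) ∈ Icc (0 : ℝ) δ₁ := ⟨(hσ _ hsI).1, (hσ _ hsI).2.trans hsI.2⟩
  have heq : σ (φ g (h g)) = g := hmono.injOn hσs hg (hback1 _ hsI)
  rw [hback2 _ hsI, heq]

end Summit.QuantumFields.YangMills.Theorems.ParabolicCentreCurve
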